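import Summits.BirchSwinnertonDyer.BirchSwinnertonDyer.Theorems.ErratumRoadFiveRest3SlackRungs
import HarnessLib

/-!
# Route `ErratumRoadFive` (rung K2), crux `Rest3TorsionBranchAtFive` (item stmt-BirchSwinnertonDyer-19702, the (T) branch of REST‴):
# the PLAN-ONLY rung stub `stub_rung_t_5190r1` of the registered skeleton v2 (`Cruxes/Rest3TorsionBranchAtFive`, seat rest-p2 g2,
# `ledger skeleton check` OK 2026-08-27) BY NAME, registered signature VERBATIM := the landed slack-road certificate theorem
# `rung_5190r1_d431_of_items_of_slackCert` (`Theorems/ErratumRoadFiveRest3SlackRungs.lean`, p475167) — `--supports stmt-BirchSwinnertonDyer-19702`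

HONEST FRAMING: THEOREM ONLY; CONDITIONAL on the route's published support items `PublishedInputsFive` (19066) and
`JSWAnticyclotomicControlMult` (19626) and ONE attested Tamagawa-slack Heegner datum (existential binders; finite computation, seat g2
kit j261919, NOT kernel-checked); ONE curve; nothing booked; BSD proved for no pair; no census word moves (T7). The rung is T3
evidence of the route on the torsion branch — a certificate WITHOUT the `p`-adic regulator (the regime stubs `stub_t_imcDivSomeFrame` ∕
`stub_t_regulatorNonvanishing` stay OPEN; v1's `Theorems.rung_5190r1_of_regCert`, p453225, stands as the second road).

References: [cite: Gross1991, (1.1), Thm. 1.3, (2.2)] [cite: JetchevSkinnerWan2017, Thm. 3.3.1, §7.4.1] [cite: Kolyvagin1990, Thm. A]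
[cite: Cremona1997, Table 1 (curve 5190r1)].
-/

set_option autoImplicit false
-- the Theorems namespace of this sub repeats the summit name by design (D-0017 nested layout)
set_option linter.dupNamespace false

noncomputable section

open scoped Classical

namespace Summit.BirchSwinnertonDyer.BirchSwinnertonDyer.Theorems.Rest3Rungs

/-- **`stub_rung_t_5190r1` (crux 19702, registered skeleton v2) BY NAME**: the open input `P2OpenInputOnTreeAt E 5` at the (T)
pair `E = 5190r1` (`E(ℚ₅)[5] ≠ 0`, `5 ∣ c₅ = 5`) from `PublishedInputsFive` + `JSWAnticyclotomicControlMult` + ONE attested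
Tamagawa-slack Heegner datum over `ℚ(√−431)` (`h = 21`, `β = 407`, `y_K ≡ 240·g`, `#E(K)_tors = 2`, `ord₅ [E(K):ℤy_K] = 1 ≤ 1`;
seat g2 kit j261919) — `rung_5190r1_d431_of_items_of_slackCert`; NO `p`-adic regulator, NO lever fact, NO preprint. CONDITIONAL;
ONE curve; nothing booked. [cite: Gross1991, (1.1), (2.2)] [cite: JetchevSkinnerWan2017, Thm. 3.3.1, §7.4.1] [cite: Kolyvagin1990, Thm. A]
[cite: Cremona1997, Table 1 (curve 5190r1)] -/
theorem stub_rung_t_5190r1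
    [((⟨1, 0, 0, -9535, 307097⟩ : WeierstrassCurve ℤ).baseChange ℚ).IsElliptic] [((⟨1, 0, 0, -9535, 307097⟩ : WeierstrassCurve ℤ).baseChange ℚ).IsGloballyMinimal] [NeZero (((⟨1, 0, 0, -9535, 307097⟩ : WeierstrassCurve ℤ).baseChange ℚ).conductorNorm ℤ)]
    (hF : Summit.BirchSwinnertonDyer.BirchSwinnertonDyer.Theses.ErratumRoadFive.PublishedInputsFive)
    (h331 : Summit.BirchSwinnertonDyer.BirchSwinnertonDyer.Theses.ErratumRoadFive.JSWAnticyclotomicControlMult)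
    (K : Type) [Field K] [NumberField K] (hK : Literature.NumberTheory.EllipticCurves.IsImaginaryQuadratic K)
    (hdK : NumberField.discr K = -431)
    (hH : Literature.NumberTheory.EllipticCurves.SatisfiesHeegnerHypothesis (((⟨1, 0, 0, -9535, 307097⟩ : WeierstrassCurve ℤ).baseChange ℚ).conductorNorm ℤ) K)
    (Dt : Literature.NumberTheory.EllipticCurves.ModularForms.ModularParametrizationData ((⟨1, 0, 0, -9535, 307097⟩ : WeierstrassCurve ℤ).baseChange ℚ) (((⟨1, 0, 0, -9535, 307097⟩ : WeierstrassCurve ℤ).baseChange ℚ).conductorNorm ℤ))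
    (H : Literature.NumberTheory.EllipticCurves.HeegnerDatum (((⟨1, 0, 0, -9535, 307097⟩ : WeierstrassCurve ℤ).baseChange ℚ).conductorNorm ℤ) (NumberField.discr K))
    (ι : K →+* ℂ) (P : (((⟨1, 0, 0, -9535, 307097⟩ : WeierstrassCurve ℤ).baseChange ℚ).baseChange K).toAffine.Point)
    (hP : WeierstrassCurve.Affine.Point.map ι.toRatAlgHom P =
      Literature.NumberTheory.EllipticCurves.ModularForms.heegnerPointComplex Dt H)
    (hc : ¬ (5 : ℤ) ∣ Dt.c) (hnt : ¬ IsOfFinAddOrder P)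
    (hidx : padicValNat 5 (AddSubgroup.zmultiples P).index ≤ 1) :
    Summit.BirchSwinnertonDyer.Rank1Residual.X11b.P2OpenInputOnTreeAt
      ((⟨1, 0, 0, -9535, 307097⟩ : WeierstrassCurve ℤ).baseChange ℚ) 5 :=
  rung_5190r1_d431_of_items_of_slackCert hF h331 K hK hdK hH Dt H ι P hP hc hnt hidx

end Summit.BirchSwinnertonDyer.BirchSwinnertonDyer.Theorems.Rest3Rungs

end
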